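import Summits.BirchSwinnertonDyer.BirchSwinnertonDyer.Theorems.ResidualThetaTransportAtTwoThetaLayerLambdaCongruenceAtTwoCuspSpanTriangle
import Summits.BirchSwinnertonDyer.BirchSwinnertonDyer.Theorems.ResidualThetaTransportAtTwoThetaLayerLambdaCongruenceAtTwoCuspSpanHenselFour
import Summits.BirchSwinnertonDyer.BirchSwinnertonDyer.Theorems.ResidualThetaTransportAtTwoThetaLayerLambdaCongruenceAtTwoCuspSpanAuxPrime
import Mathlib.RingTheory.PrincipalIdealDomain
import HarnessLib

/-!
# Route `ResidualThetaTransportAtTwo`, node 27436 (cruxes Kan⁺ stmt-BirchSwinnertonDyer-20688 / Kμ⁺ 20689 / 21437): the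
# `q`-ADIC TRIANGLE RULE — at every odd prime level `p`, for every odd prime `q ≠ p`, the `B₁`-character `F` satisfies
# `F(w) = F(u) + F(w/u)` for all units `u` and all `w ∈ −⟨q⟩ ⊂ (ℤ/p)ˣ`; hence `F(q^j v) = F(q^j) + F(v)`

Cell `bsd-wall`, width seat `bsd-wall-rtt-p3-w2` g4 (2026-08-28). THEOREMS ONLY (no `def`, no `sorry`, no named fact);
`--supports stmt-BirchSwinnertonDyer-20688`; BSD is not proved by this.

SETTING (as in `…CuspSpanGenerationB1` / `…CuspSpanFourInvariance`): `χ : Γ₀(p) → ZMod 2` additive, killing the small-trace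
elements (`hsmall`) and the elements with lower-right entry `±4^k`, `k ≥ 1` (`hkill`); `F(u) := χ(β)` for `b(β) = −1`, `d(β) ≡ u`.

THE CONSTRUCTION (`chi_b1_rule_of_neg_prime_pow`). Given units `u`, `w = −q^s` of `ZMod p` (`w ≠ −1`; the case `w = −1` is the
`S`-rule), put `n₀ := −(w+1)/u`. Take `e` from `exists_hensel_four` and the auxiliary prime `n` of `exists_aux_prime`
(`n ≡ n₀ (p)`, `q^e ∣ n+1`, `n ≡ 3 (4)`, `h := (n−1)/2` prime to `p−1`, `q^h ≡ 1 (n)`). CRT gives `t ≥ 1` with `h ∣ t`,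
`t ≡ s (mod p−1)`; then `q^t ≡ 1 (mod n)` and `q^t ≡ q^s = −w (mod p)` (Fermat). With `d := (q^t − 1)/n` one has `d ≡ u (mod p)`;
`g := (a, −1; pκ, d)`, `β' := (α', −1; pκ', d')`, `d' := −n − a ≡ w/u`. The product `gβ'` has upper-right entry `n` and
lower-right entry `−1 − dn = −q^t`; its lower-left entry `c₂` satisfies `n c₂ ≡ −1 (mod q^t)`, and `n ≡ −1 (mod q^e)` gives
`c₂ ≡ 1 (mod q^{min(e,t)})`, so HENSEL yields `k ≥ 1` with `q^t ∣ 4^k − c₂`: the triangle lemma (`…CuspSpanTriangle`) applies and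
`F(u) + F(w/u) = χ(g) + χ(β') = F(−q^t) = F(w)`.
No Artin-type input: the prime factor `n` of `q^t − 1` is chosen FIRST (Dirichlet + reciprocity), the exponent `t` second.

* `chi_b1_rule_of_neg_prime_pow` — the rule; * `chi_b1_mul_prime_pow` — **`F(q^j v) = F(q^j) + F(v)`** for every odd prime
`q ≠ p`, every `j`, every unit `v` (rule at `w = −q^j`, `u = −1/v`, plus `F(−q^j) = F(q^j)` from the rule at `u = −1`).
The sequel `…CuspSpanPrimeLevel` multiplies these up (odd primes generate `(ℤ/p)ˣ`) to `F` multiplicative and the node at every prime.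

References: P. G. L. Dirichlet (1837) / Mathlib `PrimesInAP`; [Rademacher1929] §1; [Knapp1993] Prop. 11.1; [Pollack2003] Conj. 6.3.
-/

set_option autoImplicit false
set_option linter.dupNamespace false

open scoped MatrixGroups

open CongruenceSubgroup

namespace Summit.BirchSwinnertonDyer.BirchSwinnertonDyer.Theorems.SignedMuAtTwo

section PrimeLevel

variable {p : ℕ} [Fact p.Prime] {χ : Gamma0 p → ZMod 2}

/-- For a prime `p` and an integer `d` whose class mod `p` is non-zero: `IsCoprime d p`. [folklore] -/
theorem isCoprime_int_of_cast_ne_zero {d : ℤ} (hd : ((d : ℤ) : ZMod p) ≠ 0) : IsCoprime d (p : ℤ) := by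
  have hp : p.Prime := Fact.out
  have hpI : Irreducible (p : ℤ) := (Nat.prime_iff_prime_int.mp hp).irreducible
  refine (hpI.coprime_iff_not_dvd.mpr ?_).symm
  intro h
  exact hd ((ZMod.intCast_zmod_eq_zero_iff_dvd d p).mpr h)

/-- **The `q`-adic triangle rule.** At an odd prime level `p`, for an odd prime `q ≠ p` and `b = −1` elements `β_w, β_u, β_v` of
`Γ₀(p)` with `d(β_w) ≡ −q^s`, and `d(β_v) d(β_u) ≡ d(β_w)` (mod `p`): `χ β_w = χ β_u + χ β_v` — i.e. `F(w) = F(u) + F(w/u)` for every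
unit `u` and every `w ∈ −⟨q⟩`. [cite: Rademacher1929, §1] [cite: Pollack2003, Conj. 6.3] -/
theorem chi_b1_rule_of_neg_prime_pow (hp2 : p ≠ 2)
    (hadd : ∀ γ δ : Gamma0 p, χ (γ * δ) = χ γ + χ δ)
    (hsmall : ∀ γ : Gamma0 p, ((γ : SL(2, ℤ)) 0 0 + (γ : SL(2, ℤ)) 1 1).natAbs ≤ 2 → χ γ = 0)
    (hkill : ∀ γ : Gamma0 p, (∃ k : ℕ, 1 ≤ k ∧ ((γ : SL(2, ℤ)) 1 1).natAbs = 4 ^ k) → χ γ = 0)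
    (q : ℕ) (hq : q.Prime) (hq2 : q ≠ 2) (hqp : q ≠ p) (s : ℕ)
    {βw βu βv : Gamma0 p} (hbw : (βw : SL(2, ℤ)) 0 1 = -1) (hbu : (βu : SL(2, ℤ)) 0 1 = -1)
    (hbv : (βv : SL(2, ℤ)) 0 1 = -1)
    (hw : ((((βw : SL(2, ℤ)) 1 1 : ℤ) : ZMod p)) = -(q : ZMod p) ^ s)
    (hv : ((((βv : SL(2, ℤ)) 1 1 : ℤ) : ZMod p)) * ((((βu : SL(2, ℤ)) 1 1 : ℤ) : ZMod p)) =
      ((((βw : SL(2, ℤ)) 1 1 : ℤ) : ZMod p))) :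
    χ βw = χ βu + χ βv := by
  have hp : p.Prime := Fact.out
  have hp3 : 3 ≤ p := by
    have := hp.two_le; rcases Nat.lt_or_ge 2 p with h | h
    · omega
    · exfalso; exact hp2 (le_antisymm h hp.two_le)
  have hUu : IsUnit ((((βu : SL(2, ℤ)) 1 1 : ℤ) : ZMod p)) := isUnit_gamma0_apply_one_one βu
  have hVu : IsUnit ((((βv : SL(2, ℤ)) 1 1 : ℤ) : ZMod p)) := isUnit_gamma0_apply_one_one βv
  -- name the residues `W, U, V`
  generalize hW : ((((βw : SL(2, ℤ)) 1 1 : ℤ) : ZMod p)) = W at hw hv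
  generalize hU : ((((βu : SL(2, ℤ)) 1 1 : ℤ) : ZMod p)) = U at hv hUu
  generalize hV : ((((βv : SL(2, ℤ)) 1 1 : ℤ) : ZMod p)) = V at hv hVu
  have hU0 : U ≠ 0 := hUu.ne_zero
  have hV0 : V ≠ 0 := hVu.ne_zero
  -- the class of `q` mod `p` and Fermat
  have hq0 : (q : ZMod p) ≠ 0 := by
    intro h0
    have := (ZMod.natCast_eq_zero_iff q p).mp h0
    exact hqp ((Nat.prime_dvd_prime_iff_eq hp hq).mp this).symm
  have hFermat : ∀ m : ℕ, (q : ZMod p) ^ m = (q : ZMod p) ^ (m % (p - 1)) := fun m ↦ by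
    conv_lhs => rw [← Nat.div_add_mod m (p - 1), pow_add, pow_mul, ZMod.pow_card_sub_one_eq_one hq0, one_pow, one_mul]
  -- CASE `w = −1`: the `S`-rule
  by_cases hW1 : W = -1
  · have h0 : χ βw = 0 := chi_eq_zero_of_b_neg_one_of_d_neg_one hadd hsmall βw hbw (by rw [hW, hW1])
    have h1 : χ βv = χ βu :=
      chi_eq_of_b_neg_one_of_mul_d_eq_neg_one hadd hsmall hbv hbu (by rw [hV, hU, hv, hW1])
    rw [h0, h1]; exact (CharTwo.add_self_eq_zero _).symm
  -- CASE `w ≠ −1`: the construction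
  have hW10 : W + 1 ≠ 0 := fun h ↦ hW1 (by linear_combination h)
  have hn₀0 : -(W + 1) * U⁻¹ ≠ 0 := mul_ne_zero (neg_ne_zero.mpr hW10) (inv_ne_zero hU0)
  generalize hn₀ : -(W + 1) * U⁻¹ = n₀ at hn₀0
  have ha₀p : ¬ p ∣ n₀.val := fun h ↦ by
    have : n₀.val = 0 := Nat.eq_zero_of_dvd_of_lt h (ZMod.val_lt n₀)
    exact hn₀0 ((ZMod.val_eq_zero n₀).mp this)
  -- Hensel exponent and the auxiliary prime
  obtain ⟨e, he1, -, hens⟩ := exists_hensel_four q hq hq2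
  obtain ⟨n, hnprime, hpn, -, hna, hqe, -, hcop, hqh⟩ :=
    exists_aux_prime p q hp hq hp2 hq2 (Ne.symm hqp) he1 n₀.val ha₀p
  have hncast : (n : ZMod p) = n₀ := by
    rw [(ZMod.natCast_eq_natCast_iff _ _ _).mpr hna, ZMod.natCast_zmod_val]
  have hh1 : 1 ≤ n / 2 := by omega
  -- the exponent `t`: `(n−1)/2 ∣ t`, `t ≡ s (mod p − 1)`, `t ≥ 1`
  obtain ⟨x₀, hx₀h, hx₀s⟩ := Nat.chineseRemainder hcop 0 s
  obtain ⟨t, ht⟩ : ∃ t, t = x₀ + (n / 2) * (p - 1) := ⟨_, rfl⟩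
  have ht1 : 1 ≤ t := by
    have : 1 ≤ (n / 2) * (p - 1) := Nat.one_le_iff_ne_zero.mpr (Nat.mul_ne_zero (by omega) (by omega))
    omega
  have hht : n / 2 ∣ t := by
    have : n / 2 ∣ x₀ := Nat.modEq_zero_iff_dvd.mp hx₀h
    rw [ht]; exact dvd_add this (dvd_mul_right _ _)
  have hts : t % (p - 1) = s % (p - 1) := by
    have e1 : t ≡ x₀ [MOD p - 1] := ((Nat.modEq_iff_dvd' (by omega)).mpr (by rw [ht]; simp)).symm
    exact e1.trans hx₀s
  -- `q^t ≡ 1 (mod n)` and `q^t ≡ q^s = −w (mod p)`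
  have hqtn : (n : ℤ) ∣ (q : ℤ) ^ t - 1 := by
    obtain ⟨l, hl⟩ := hht
    rw [← ZMod.intCast_zmod_eq_zero_iff_dvd]
    push_cast
    rw [hl, pow_mul, hqh, one_pow, sub_self]
  have hqtp : (q : ZMod p) ^ t = -W := by
    rw [hFermat t, hts, ← hFermat s, hw, neg_neg]
  obtain ⟨d, hd⟩ := hqtn
  -- `d ≡ u (mod p)`
  have hdU : ((d : ℤ) : ZMod p) = U := by
    have e1 := congrArg (Int.cast : ℤ → ZMod p) hd
    push_cast at e1
    rw [hqtp, hncast, ← hn₀] at e1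
    -- `e1 : −W − 1 = −(W+1) U⁻¹ d`
    have e3 : -(W + 1) * (U⁻¹ * ((d : ℤ) : ZMod p)) = -(W + 1) * 1 := by
      rw [mul_one]; linear_combination -e1
    have e4 := mul_left_cancel₀ (neg_ne_zero.mpr hW10) e3
    calc ((d : ℤ) : ZMod p) = U * (U⁻¹ * ((d : ℤ) : ZMod p)) := by
          rw [← mul_assoc, mul_inv_cancel₀ hU0, one_mul]
      _ = U := by rw [e4, mul_one]
  have hcd : IsCoprime d (p : ℤ) := isCoprime_int_of_cast_ne_zero (by rw [hdU]; exact hU0)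
  obtain ⟨a, κ, hak⟩ := hcd
  obtain ⟨g, hg00, hg01, hg10, hg11⟩ := ThetaLayerLambdaCongruenceAtTwo.exists_gamma0_entries (N := p)
    a (-1) (p * κ) d (by linear_combination hak) (dvd_mul_right _ _)
  have haU : ((a : ℤ) : ZMod p) * U = 1 := by
    have e1 := congrArg (Int.cast : ℤ → ZMod p) hak
    push_cast at e1
    rw [ZMod.natCast_self, mul_zero, add_zero, hdU] at e1
    exact e1
  have ha' : ((a : ℤ) : ZMod p) = U⁻¹ := by
    calc ((a : ℤ) : ZMod p) = ((a : ℤ) : ZMod p) * (U * U⁻¹) := by rw [mul_inv_cancel₀ hU0, mul_one]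
      _ = U⁻¹ := by rw [← mul_assoc, haU, one_mul]
  -- `d' := −n − a ≡ w/u`
  obtain ⟨d', hd'⟩ : ∃ d' : ℤ, d' = -(n : ℤ) - a := ⟨_, rfl⟩
  have hV' : V = W * U⁻¹ := by
    rw [← hv, mul_assoc, mul_inv_cancel₀ hU0, mul_one]
  have hd'V : ((d' : ℤ) : ZMod p) = V := by
    rw [hd', hV']
    push_cast
    rw [hncast, ← hn₀, ha']
    ring
  have hcd' : IsCoprime d' (p : ℤ) := isCoprime_int_of_cast_ne_zero (by rw [hd'V]; exact hV0)
  obtain ⟨α', κ', hak'⟩ := hcd'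
  obtain ⟨β', -, hb01, -, hb11⟩ := ThetaLayerLambdaCongruenceAtTwo.exists_gamma0_entries (N := p)
    α' (-1) (p * κ') d' (by linear_combination hak') (dvd_mul_right _ _)
  -- entries of `g β'`: upper-right `n`, lower-right `−q^t`
  obtain ⟨hB, hD⟩ := b1_mul_b1_entries (N := p) hg01 hb01
  rw [hg00, hb11, hd'] at hB
  rw [hg10, hg11, hb11, hd'] at hD
  have hB' : ((g * β' : Gamma0 p) : SL(2, ℤ)) 0 1 = n := by rw [hB]; ring
  have hD' : ((g * β' : Gamma0 p) : SL(2, ℤ)) 1 1 = -(q : ℤ) ^ t := by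
    rw [hD]; linear_combination hd - hak
  -- the lower-left entry `c₂`: `n c₂ ≡ −1 (mod q^t)`, so `c₂ ≡ 1 (mod q^{min(e,t)})`
  obtain ⟨c₂, hc₂⟩ : ∃ c₂ : ℤ, c₂ = ((g * β' : Gamma0 p) : SL(2, ℤ)) 1 0 := ⟨_, rfl⟩
  have hdet := Matrix.SpecialLinearGroup.det_coe ((g * β' : Gamma0 p) : SL(2, ℤ))
  rw [Matrix.det_fin_two, hB', hD', ← hc₂] at hdet
  have hqen : (q : ℤ) ^ e ∣ (n : ℤ) + 1 := by exact_mod_cast hqe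
  obtain ⟨ν, hν⟩ := hqen
  have hc₂1 : (q : ℤ) ^ (min e t) ∣ c₂ - 1 := by
    have e1 : c₂ - 1 = ((g * β' : Gamma0 p) : SL(2, ℤ)) 0 0 * (q : ℤ) ^ t + (q : ℤ) ^ e * (ν * c₂) := by
      linear_combination hdet + c₂ * hν
    rw [e1]
    exact dvd_add (dvd_mul_of_dvd_right (pow_dvd_pow _ (min_le_right _ _)) _)
      (dvd_mul_of_dvd_left (pow_dvd_pow _ (min_le_left _ _)) _)
  obtain ⟨k, hk1, hk⟩ := hens t c₂ hc₂1
  have hdvd : ((g * β' : Gamma0 p) : SL(2, ℤ)) 1 1 ∣ ((g * β' : Gamma0 p) : SL(2, ℤ)) 1 0 - 4 ^ k := by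
    rw [hD', ← hc₂, neg_dvd]
    have : c₂ - 4 ^ k = -(4 ^ k - c₂) := by ring
    rw [this, dvd_neg]; exact hk
  -- the triangle identity with `β₃ := βw`
  have hres : ((((βw : SL(2, ℤ)) 1 1 : ℤ) : ZMod p)) = ((((g * β' : Gamma0 p) : SL(2, ℤ)) 1 1 : ℤ) : ZMod p) := by
    rw [hW, hD', Int.cast_neg, Int.cast_pow, Int.cast_natCast, hqtp, neg_neg]
  have htri := chi_add_chi_eq_of_triangle hp2 hadd hsmall hkill g β' k hk1 hdvd hbw hres
  -- `χ g = χ βu`, `χ β' = χ βv`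
  have hgu : χ g = χ βu := chi_eq_of_apply_zero_one_eq_neg_one hadd hsmall hg01 hbu (by rw [hg11, hdU, hU])
  have hbv' : χ β' = χ βv := chi_eq_of_apply_zero_one_eq_neg_one hadd hsmall hb01 hbv (by rw [hb11, hd'V, hV])
  rw [← htri, hgu, hbv']

/-- **`F(q^j v) = F(q^j) + F(v)`** at an odd prime level, for every odd prime `q ≠ p`, every `j` and every unit `v`: for
`b = −1` elements `β_s, β_v, β_{sv}` with `d(β_s) ≡ q^j`, `d(β_{sv}) ≡ q^j d(β_v)`: `χ β_{sv} = χ β_s + χ β_v` (the rule at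
`w = −q^j`, `u = −1/v`, together with `F(−q^j) = F(q^j)` — the rule at `u = −1` — and the `S`-rule).
[cite: Rademacher1929, §1] [cite: Pollack2003, Conj. 6.3] -/
theorem chi_b1_mul_prime_pow (hp2 : p ≠ 2)
    (hadd : ∀ γ δ : Gamma0 p, χ (γ * δ) = χ γ + χ δ)
    (hsmall : ∀ γ : Gamma0 p, ((γ : SL(2, ℤ)) 0 0 + (γ : SL(2, ℤ)) 1 1).natAbs ≤ 2 → χ γ = 0)
    (hkill : ∀ γ : Gamma0 p, (∃ k : ℕ, 1 ≤ k ∧ ((γ : SL(2, ℤ)) 1 1).natAbs = 4 ^ k) → χ γ = 0)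
    (q : ℕ) (hq : q.Prime) (hq2 : q ≠ 2) (hqp : q ≠ p) (j : ℕ)
    {βs βv βsv : Gamma0 p} (hbs : (βs : SL(2, ℤ)) 0 1 = -1) (hbv : (βv : SL(2, ℤ)) 0 1 = -1)
    (hbsv : (βsv : SL(2, ℤ)) 0 1 = -1)
    (hs : ((((βs : SL(2, ℤ)) 1 1 : ℤ) : ZMod p)) = (q : ZMod p) ^ j)
    (hsv : ((((βsv : SL(2, ℤ)) 1 1 : ℤ) : ZMod p)) = (q : ZMod p) ^ j * ((((βv : SL(2, ℤ)) 1 1 : ℤ) : ZMod p))) :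
    χ βsv = χ βs + χ βv := by
  have hp : p.Prime := Fact.out
  have hq0 : (q : ZMod p) ≠ 0 := by
    intro h0
    have := (ZMod.natCast_eq_zero_iff q p).mp h0
    exact hqp ((Nat.prime_dvd_prime_iff_eq hp hq).mp this).symm
  have hVu : IsUnit ((((βv : SL(2, ℤ)) 1 1 : ℤ) : ZMod p)) := isUnit_gamma0_apply_one_one βv
  generalize hV : ((((βv : SL(2, ℤ)) 1 1 : ℤ) : ZMod p)) = V at hsv hVu
  have hV0 : V ≠ 0 := hVu.ne_zero
  -- `β_w` with `d ≡ −q^j`, `β_u` with `d ≡ −1/v`, `β₋₁` with `d ≡ −1`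
  have hwu : IsUnit (-(q : ZMod p) ^ j) := (isUnit_iff_ne_zero.mpr (pow_ne_zero _ hq0)).neg
  obtain ⟨βw, hbw, hdw⟩ := exists_b_neg_one_of_isUnit (N := p) hwu
  obtain ⟨βu, hbu, hdu⟩ := exists_b_neg_one_of_isUnit (N := p) (isUnit_iff_ne_zero.mpr (inv_ne_zero hV0)).neg
  obtain ⟨βm, hbm, hdm⟩ := exists_b_neg_one_of_isUnit (N := p) (isUnit_one (M := ZMod p)).neg
  -- rule at `(w, u) = (−q^j, −1/v)`: `F(−q^j) = F(−1/v) + F(q^j v)`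
  have r1 := chi_b1_rule_of_neg_prime_pow hp2 hadd hsmall hkill q hq hq2 hqp j hbw hbu hbsv hdw
    (by rw [hsv, hdu, hdw, mul_neg, mul_assoc, mul_inv_cancel₀ hV0, mul_one])
  -- rule at `(w, u) = (−q^j, −1)`: `F(−q^j) = F(−1) + F(q^j)`
  have r2 := chi_b1_rule_of_neg_prime_pow hp2 hadd hsmall hkill q hq hq2 hqp j hbw hbm hbs hdw
    (by rw [hs, hdm, hdw]; ring)
  have hm0 : χ βm = 0 := chi_eq_zero_of_b_neg_one_of_d_neg_one hadd hsmall βm hbm hdm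
  have huv : χ βu = χ βv :=
    chi_eq_of_b_neg_one_of_mul_d_eq_neg_one hadd hsmall hbu hbv (by rw [hdu, hV, neg_mul, inv_mul_cancel₀ hV0])
  rw [hm0, zero_add] at r2
  rw [r2, huv] at r1
  -- `r1 : χ βs = χ βv + χ βsv`
  have key : ∀ x y z : ZMod 2, x = y + z → z = x + y := by decide
  exact key _ _ _ r1

end PrimeLevel

end Summit.BirchSwinnertonDyer.BirchSwinnertonDyer.Theorems.SignedMuAtTwo
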